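import Summits.ResolutionOfSingularities.ResolutionOfSingularities.Theorems.WeightedInvariantHypersurfaceCentreAssemblyStalkDict
import Summits.ResolutionOfSingularities.ResolutionOfSingularities.Theorems.FrobeniusLadderFRationalResolutionSuspensionNotRegular
import Literature.AlgebraicGeometry.Resolution.PointBlowupHsFunMono
import Literature.AlgebraicGeometry.Resolution.MarkedIdeals
import HarnessLib

/-!
# Door assembly H2c″ — point dictionary: the non-regular locus of a hypersurface through its local equation

Route `ResolutionOfSingularities/WeightedInvariant`, crux `Theses.WeightedInvariant.HypersurfaceCentreConstruction`
(stmt-ResolutionOfSingularities-19897), door line `local-engine`, skeleton v3/v3.1, stubs [S3]/[S4]/[S6]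
(res-L1-w43-stub-9 = res-D-brk-1). Def-free dictionary between the three descriptions of «`y` is a singular point of the
hypersurface `V(X) ⊆ Y`» used when the ∀-model open-presentation clause (`JOpenPresentationForallSing`, TP5′+TP5″) is
instantiated on an affine chart `U₀ = Spec A` with `X(U₀) = (F)`:

* `mem_singImage_iff_not_isRegularLocalRing_quotient` — `y ∈ singImage X` iff `𝒪_{Y,y}/X_y` is not regular;
* `mem_singImage_iff_mem_sq_of_stalkIdeal_eq` — for `𝒪_{Y,y}` regular and `X_y = (g)` with `g ≠ 0`: iff `g ∈ 𝔪_y²`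
  (Matsumura 14.2 both ways: `IsRegularLocalRing.quotient_span_singleton`, `not_isRegularLocalRing_quotient_of_mem_sq`);
* `algebraMap_mem_maximalIdeal_pow_iff_germ_mem`, `algebraMap_eq_zero_iff_germ_eq_zero`, `germ_mem_maximalIdeal_iff_mem` —
  the model `A_𝔮 = Γ(Y,U₀)_{𝔮_y}` and the stalk `𝒪_{Y,y}` see the same conditions on sections;
* `exists_not_mem_forall_algebraMap_ne_zero` — Noetherian `A`, `A_𝔪` a domain, `F/1 ≠ 0` in `A_𝔪`: then `F/1 ≠ 0` in `A_𝔮`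
  for every prime `𝔮` of a basic open neighbourhood `D(h) ∋ 𝔪` (the irreducible components missing `𝔪` are cut away).

OURS bookkeeping; no claim about Hironaka's problem. [folklore; cite: Matsumura1987, Thm. 14.2]
-/

noncomputable section

set_option linter.dupNamespace false -- mandated namespace of this single-conjunct summit

open CategoryTheory AlgebraicGeometry TopologicalSpace IsLocalRing
open Literature.AlgebraicGeometry.Resolution
open Summit.ResolutionOfSingularities.ResolutionOfSingularities.Theorems

namespace Summit.ResolutionOfSingularities.ResolutionOfSingularities.Cruxes.HypersurfaceCentreConstruction.LocalEngine

/-! ## Localisation bookkeeping (any localisation at a prime, in particular the model `A_𝔮` and the stalk `𝒪_{Y,y}`) -/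

/-- `a/1 ∈ 𝔪_O^N` iff `s a ∈ 𝔭^N` for some `s ∉ 𝔭`, for any localisation `O` of `A` at the prime `𝔭`.
[cite: Matsumura1987, §4] -/
theorem algebraMap_mem_maximalIdeal_pow_iff_exists {A : Type*} [CommRing A] (𝔭 : Ideal A) [𝔭.IsPrime]
    (O : Type*) [CommRing O] [Algebra A O] [IsLocalization.AtPrime O 𝔭] [IsLocalRing O] (N : ℕ) (a : A) :
    algebraMap A O a ∈ maximalIdeal O ^ N ↔ ∃ s ∉ 𝔭, s * a ∈ 𝔭 ^ N := by
  rw [← IsLocalization.AtPrime.map_eq_maximalIdeal 𝔭 O, ← Ideal.map_pow,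
    IsLocalization.algebraMap_mem_map_algebraMap_iff 𝔭.primeCompl]
  exact ⟨fun ⟨s, hs, h⟩ => ⟨s, hs, h⟩, fun ⟨s, hs, h⟩ => ⟨s, hs, h⟩⟩

/-- `a/1 = 0` in a localisation `O` of `A` at `𝔭` iff `s a = 0` for some `s ∉ 𝔭`. [folklore] -/
theorem algebraMap_eq_zero_iff_exists {A : Type*} [CommRing A] (𝔭 : Ideal A) [𝔭.IsPrime]
    (O : Type*) [CommRing O] [Algebra A O] [IsLocalization.AtPrime O 𝔭] (a : A) :
    algebraMap A O a = 0 ↔ ∃ s ∉ 𝔭, s * a = 0 := by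
  rw [IsLocalization.map_eq_zero_iff 𝔭.primeCompl]
  exact ⟨fun ⟨s, h⟩ => ⟨s, s.2, h⟩, fun ⟨s, hs, h⟩ => ⟨⟨s, hs⟩, h⟩⟩

section Stalk

variable {Y : Scheme.{0}} (U : Y.affineOpens) {y : Y} (hy : y ∈ (U : Y.Opens))

/-- Model ↔ stalk: `F/1 ∈ 𝔪_{A_𝔮}^N` iff `germ_y F ∈ 𝔪_y^N` (`A = Γ(Y, U)`, `𝔮` the prime of `y`). [folklore] -/
theorem algebraMap_mem_maximalIdeal_pow_iff_germ_mem (F : Γ(Y, U)) (N : ℕ) :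
    algebraMap Γ(Y, U) (Localization.AtPrime (U.2.primeIdealOf ⟨y, hy⟩).asIdeal) F ∈
        maximalIdeal (Localization.AtPrime (U.2.primeIdealOf ⟨y, hy⟩).asIdeal) ^ N ↔
      (Y.presheaf.germ (U : Y.Opens) y hy).hom F ∈ maximalIdeal (Y.presheaf.stalk y) ^ N := by
  letI := TopCat.Presheaf.algebra_section_stalk Y.presheaf (⟨y, hy⟩ : (U : Y.Opens))
  haveI := U.2.isLocalization_stalk ⟨y, hy⟩
  rw [algebraMap_mem_maximalIdeal_pow_iff_exists (U.2.primeIdealOf ⟨y, hy⟩).asIdeal]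
  exact (algebraMap_mem_maximalIdeal_pow_iff_exists (U.2.primeIdealOf ⟨y, hy⟩).asIdeal
    (Y.presheaf.stalk y) N F).symm

/-- Model ↔ stalk: `F/1 = 0` in `A_𝔮` iff `germ_y F = 0`. [folklore] -/
theorem algebraMap_eq_zero_iff_germ_eq_zero (F : Γ(Y, U)) :
    algebraMap Γ(Y, U) (Localization.AtPrime (U.2.primeIdealOf ⟨y, hy⟩).asIdeal) F = 0 ↔
      (Y.presheaf.germ (U : Y.Opens) y hy).hom F = 0 := by
  letI := TopCat.Presheaf.algebra_section_stalk Y.presheaf (⟨y, hy⟩ : (U : Y.Opens))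
  haveI := U.2.isLocalization_stalk ⟨y, hy⟩
  rw [algebraMap_eq_zero_iff_exists (U.2.primeIdealOf ⟨y, hy⟩).asIdeal]
  exact (algebraMap_eq_zero_iff_exists (U.2.primeIdealOf ⟨y, hy⟩).asIdeal (Y.presheaf.stalk y) F).symm

/-- A section vanishes at `y` (its germ lies in `𝔪_y`) iff it lies in the prime of `y`. [folklore] -/
theorem germ_mem_maximalIdeal_iff_mem (s : Γ(Y, U)) :
    (Y.presheaf.germ (U : Y.Opens) y hy).hom s ∈ maximalIdeal (Y.presheaf.stalk y) ↔
      s ∈ (U.2.primeIdealOf ⟨y, hy⟩).asIdeal := by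
  letI := TopCat.Presheaf.algebra_section_stalk Y.presheaf (⟨y, hy⟩ : (U : Y.Opens))
  haveI := U.2.isLocalization_stalk ⟨y, hy⟩
  exact IsLocalization.AtPrime.to_map_mem_maximal_iff (Y.presheaf.stalk y) (U.2.primeIdealOf ⟨y, hy⟩).asIdeal s

/-- `y ∈ D(s)` iff `s` is not in the prime of `y`. [folklore] -/
theorem mem_basicOpen_iff_not_mem (s : Γ(Y, U)) :
    y ∈ Y.basicOpen s ↔ s ∉ (U.2.primeIdealOf ⟨y, hy⟩).asIdeal := by
  letI := TopCat.Presheaf.algebra_section_stalk Y.presheaf (⟨y, hy⟩ : (U : Y.Opens))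
  haveI := U.2.isLocalization_stalk ⟨y, hy⟩
  rw [Y.mem_basicOpen s y hy]
  exact IsLocalization.AtPrime.isUnit_to_map_iff (Y.presheaf.stalk y) (U.2.primeIdealOf ⟨y, hy⟩).asIdeal s

end Stalk

/-! ## The non-regular locus through the local equation -/

section SingImage

variable {Y : Scheme.{0}} (X : Y.IdealSheafData)

/-- A point of the image of the non-regular locus of `V(X)` lies in the support of `X`. [folklore] -/
theorem mem_support_of_mem_singImage {y : Y} (hy : y ∈ singImage X) : y ∈ X.support := by
  obtain ⟨x, hx, -⟩ := hy
  have : y ∈ Set.range X.subschemeι := ⟨x, hx⟩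
  rwa [Scheme.IdealSheafData.range_subschemeι] at this

/-- **`y ∈ singImage X` iff the quotient stalk `𝒪_{Y,y}/X_y` is not a regular local ring** (for `y` in the support;
the stalks of `V(X)` over `y` are all this quotient, `isRegularLocalRing_stalk_subscheme_iff`). [folklore] -/
theorem mem_singImage_iff_not_isRegularLocalRing_quotient {y : Y} (hy : y ∈ X.support) :
    y ∈ singImage X ↔ ¬ IsRegularLocalRing (Y.presheaf.stalk y ⧸ stalkIdeal X y) := by
  constructor
  · rintro ⟨x, hx, hnot⟩ hreg
    apply hnot
    rw [isRegularLocalRing_stalk_subscheme_iff]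
    have hx' : X.subschemeι.base x = y := hx
    rw [hx']
    exact hreg
  · intro hnot
    obtain ⟨x, hx⟩ : y ∈ Set.range X.subschemeι := by
      rw [Scheme.IdealSheafData.range_subschemeι]
      exact hy
    refine ⟨x, hx, fun hreg => hnot ?_⟩
    rw [isRegularLocalRing_stalk_subscheme_iff] at hreg
    have hx' : X.subschemeι.base x = y := hx
    rwa [hx'] at hreg

/-- A local equation of `X` at a point of `singImage X` with regular ambient stalk is non-zero (else `V(X)` would contain
the regular germ `Spec 𝒪_{Y,y}`). [folklore] -/
theorem ne_zero_of_mem_singImage_of_stalkIdeal_eq {y : Y} [IsRegularLocalRing (Y.presheaf.stalk y)]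
    {g : Y.presheaf.stalk y} (hg : stalkIdeal X y = Ideal.span {g}) (hy : y ∈ singImage X) : g ≠ 0 := by
  rintro rfl
  apply (mem_singImage_iff_not_isRegularLocalRing_quotient X (mem_support_of_mem_singImage X hy)).mp hy
  have hbot : stalkIdeal X y = ⊥ := by rw [hg, Ideal.span_singleton_eq_bot]
  rw [hbot]
  exact IsRegularLocalRing.of_ringEquiv (RingEquiv.quotientBot (Y.presheaf.stalk y)).symm

/-- **`y ∈ singImage X` iff the local equation lies in `𝔪_y²`**, for `𝒪_{Y,y}` regular and `X_y = (g)` with `g ≠ 0`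
(⇐: embedding dimension stays, dimension drops; ⇒: Matsumura 14.2). [cite: Matsumura1987, Thm. 14.2] -/
theorem mem_singImage_iff_mem_sq_of_stalkIdeal_eq {y : Y} [IsRegularLocalRing (Y.presheaf.stalk y)]
    {g : Y.presheaf.stalk y} (hg : stalkIdeal X y = Ideal.span {g}) (hg0 : g ≠ 0) :
    y ∈ singImage X ↔ g ∈ maximalIdeal (Y.presheaf.stalk y) ^ 2 := by
  constructor
  · intro hy
    have hsupp := mem_support_of_mem_singImage X hy
    have hgm : g ∈ maximalIdeal (Y.presheaf.stalk y) := by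
      have h := (mem_support_iff_stalkIdeal_le X y).mp hsupp
      rw [hg] at h
      exact h (Ideal.mem_span_singleton_self g)
    by_contra h2
    have hreg := (IsRegularLocalRing.quotient_span_singleton hgm h2).1
    rw [← hg] at hreg
    exact (mem_singImage_iff_not_isRegularLocalRing_quotient X hsupp).mp hy hreg
  · intro h2
    have hgm : g ∈ maximalIdeal (Y.presheaf.stalk y) := Ideal.pow_le_self two_ne_zero h2
    have hsupp : y ∈ X.support := by
      rw [mem_support_iff_stalkIdeal_le, hg, Ideal.span_le, Set.singleton_subset_iff]
      exact hgm
    rw [mem_singImage_iff_not_isRegularLocalRing_quotient X hsupp, hg]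
    exact FRationalResolution.not_isRegularLocalRing_quotient_of_mem_sq h2 hg0

variable (U : Y.affineOpens) {y : Y} (hy : y ∈ (U : Y.Opens))

/-- **Chart form.** On an affine `U ∋ y` with `X(U) = (F)` and `𝒪_{Y,y}` regular: if `germ_y F ≠ 0` then
`y ∈ singImage X ↔ germ_y F ∈ 𝔪_y²`. [cite: Matsumura1987, Thm. 14.2] -/
theorem mem_singImage_iff_germ_mem_sq [IsRegularLocalRing (Y.presheaf.stalk y)] {F : Γ(Y, U)}
    (hF : X.ideal U = Ideal.span {F}) (h0 : (Y.presheaf.germ (U : Y.Opens) y hy).hom F ≠ 0) :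
    y ∈ singImage X ↔ (Y.presheaf.germ (U : Y.Opens) y hy).hom F ∈ maximalIdeal (Y.presheaf.stalk y) ^ 2 :=
  mem_singImage_iff_mem_sq_of_stalkIdeal_eq X (stalkIdeal_eq_span_germ (hy := hy) X hF) h0

/-- **Chart form, non-vanishing.** On an affine `U ∋ y` with `X(U) = (F)` and `𝒪_{Y,y}` regular: if `y ∈ singImage X`
then `germ_y F ≠ 0`. [folklore] -/
theorem germ_ne_zero_of_mem_singImage [IsRegularLocalRing (Y.presheaf.stalk y)] {F : Γ(Y, U)}
    (hF : X.ideal U = Ideal.span {F}) (hys : y ∈ singImage X) : (Y.presheaf.germ (U : Y.Opens) y hy).hom F ≠ 0 :=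
  ne_zero_of_mem_singImage_of_stalkIdeal_eq X (stalkIdeal_eq_span_germ (hy := hy) X hF) hys

/-- **Model form.** On an affine `U ∋ y` with `X(U) = (F)`, `A = Γ(Y, U)`, `𝔮` the prime of `y`, `𝒪_{Y,y}` regular and
`F/1 ≠ 0` in `A_𝔮`: `y ∈ singImage X ↔ F/1 ∈ 𝔪_{A_𝔮}²`. [cite: Matsumura1987, Thm. 14.2] -/
theorem mem_singImage_iff_algebraMap_mem_sq [IsRegularLocalRing (Y.presheaf.stalk y)] {F : Γ(Y, U)}
    (hF : X.ideal U = Ideal.span {F})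
    (h0 : algebraMap Γ(Y, U) (Localization.AtPrime (U.2.primeIdealOf ⟨y, hy⟩).asIdeal) F ≠ 0) :
    y ∈ singImage X ↔
      algebraMap Γ(Y, U) (Localization.AtPrime (U.2.primeIdealOf ⟨y, hy⟩).asIdeal) F ∈
        maximalIdeal (Localization.AtPrime (U.2.primeIdealOf ⟨y, hy⟩).asIdeal) ^ 2 := by
  rw [algebraMap_mem_maximalIdeal_pow_iff_germ_mem]
  refine mem_singImage_iff_germ_mem_sq X U hy hF fun h => h0 ?_
  rwa [algebraMap_eq_zero_iff_germ_eq_zero]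

end SingImage

/-! ## Cutting away the irreducible components missing the point -/

/-- **`F/1 ≠ 0` spreads from `A_𝔪` to a basic open neighbourhood.** Let `A` be Noetherian, `𝔪` a prime with `A_𝔪` a
domain and `F/1 ≠ 0` in `A_𝔪`. Then there is `h ∉ 𝔪` with `F/1 ≠ 0` in `A_𝔮` for every prime `𝔮 ∌ h`: take `h` in every
minimal prime not contained in `𝔪` (finitely many; prime avoidance) — a prime `𝔮 ∌ h` then contains the unique minimal prime
`𝔭₀ = ker (A → A_𝔪)` below `𝔪`, and `s F = 0` with `s ∉ 𝔮` would put `F` in `𝔭₀`. [folklore] -/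
theorem exists_not_mem_forall_algebraMap_ne_zero {A : Type*} [CommRing A] [IsNoetherianRing A] (𝔪 : Ideal A)
    [𝔪.IsPrime] [IsDomain (Localization.AtPrime 𝔪)] {F : A}
    (hF : algebraMap A (Localization.AtPrime 𝔪) F ≠ 0) :
    ∃ h : A, h ∉ 𝔪 ∧ ∀ (𝔮 : Ideal A) [𝔮.IsPrime], h ∉ 𝔮 → algebraMap A (Localization.AtPrime 𝔮) F ≠ 0 := by
  classical
  -- `𝔭₀ = ker (A → A_𝔪)`: a prime contained in every prime `𝔮 ≤ 𝔪`, not containing `F`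
  set 𝔭₀ : Ideal A := RingHom.ker (algebraMap A (Localization.AtPrime 𝔪)) with h𝔭₀def
  have h𝔭₀ : 𝔭₀.IsPrime := RingHom.ker_isPrime _
  have hsub : ∀ 𝔮 : Ideal A, 𝔮.IsPrime → 𝔮 ≤ 𝔪 → 𝔭₀ ≤ 𝔮 := by
    intro 𝔮 h𝔮 hle a ha
    rw [h𝔭₀def, RingHom.mem_ker, algebraMap_eq_zero_iff_exists 𝔪] at ha
    obtain ⟨t, ht, hta⟩ := ha
    have hta' : t * a ∈ 𝔮 := by rw [hta]; exact 𝔮.zero_mem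
    exact (h𝔮.mem_or_mem hta').resolve_left fun h => ht (hle h)
  have hF𝔭₀ : F ∉ 𝔭₀ := fun h => hF (by rwa [h𝔭₀def, RingHom.mem_ker] at h)
  -- the minimal primes not inside `𝔪`, and an `h` in all of them but not in `𝔪`
  have hfin := minimalPrimes.finite_of_isNoetherianRing A
  let S : Finset (Ideal A) := hfin.toFinset.filter fun 𝔭 => ¬ 𝔭 ≤ 𝔪
  have hinf : ¬ S.inf id ≤ 𝔪 := by
    rw [(inferInstance : 𝔪.IsPrime).inf_le']
    rintro ⟨𝔭, h𝔭S, h𝔭le⟩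
    exact (Finset.mem_filter.mp h𝔭S).2 h𝔭le
  obtain ⟨h, hhS, hh𝔪⟩ := SetLike.not_le_iff_exists.mp hinf
  refine ⟨h, hh𝔪, fun 𝔮 _ hh𝔮 hF𝔮 => ?_⟩
  -- a minimal prime below `𝔮`; it lies inside `𝔪` (else it contains `h`), hence contains `𝔭₀`
  obtain ⟨𝔭, h𝔭min, h𝔭𝔮⟩ := Ideal.exists_minimalPrimes_le (I := (⊥ : Ideal A)) (J := 𝔮) bot_le
  have h𝔭𝔪 : 𝔭 ≤ 𝔪 := by
    by_contra hnot
    have h𝔭S : 𝔭 ∈ S := Finset.mem_filter.mpr ⟨hfin.mem_toFinset.mpr h𝔭min, hnot⟩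
    exact hh𝔮 (h𝔭𝔮 ((Finset.inf_le h𝔭S : S.inf id ≤ id 𝔭) hhS))
  have h𝔭₀𝔮 : 𝔭₀ ≤ 𝔮 := (hsub 𝔭 h𝔭min.1.1 h𝔭𝔪).trans h𝔭𝔮
  -- `F/1 = 0` in `A_𝔮`: `s F = 0` with `s ∉ 𝔮`, so `s F ∈ 𝔭₀` — contradiction either way
  obtain ⟨s, hs, hsF⟩ := (algebraMap_eq_zero_iff_exists 𝔮 (Localization.AtPrime 𝔮) F).mp hF𝔮
  have hsF' : s * F ∈ 𝔭₀ := by rw [hsF]; exact 𝔭₀.zero_mem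
  rcases h𝔭₀.mem_or_mem hsF' with h1 | h1
  · exact hs (h𝔭₀𝔮 h1)
  · exact hF𝔭₀ h1

end Summit.ResolutionOfSingularities.ResolutionOfSingularities.Cruxes.HypersurfaceCentreConstruction.LocalEngine

end
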